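import Literature.Analysis.FluidPDE.Wei2016RealAssembly
import Literature.Analysis.FluidPDE.Wei2016Lemma23
import Literature.Analysis.FluidPDE.Wei2016SwirlGradBound
import Literature.Analysis.FluidPDE.Wei2016HessianLaplacianL2
import Literature.Analysis.FluidPDE.AxisymOmegaEnergy
import Literature.Analysis.FluidPDE.AxisymJEnergy
import Literature.Analysis.FluidPDE.AxisymJSourceEstimate
import Literature.Analysis.FluidPDE.HouLiVariablesMemLp
import Literature.Analysis.FluidPDE.AxisymQuotientBounds
import HarnessLib

/-!
# Wei 2016, §3, (3.1)–(3.6) at a fixed time: the differential inequality for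
# `A = ‖J‖² + ½ε^{2/3}‖Ω‖²` of an axisymmetric smooth solution

Analysis/FluidPDE proof file (theorems only; no definitions, no named facts) on the way to
`Literature.Analysis.FluidPDE.Wei2016_logModulus_regularity`
(`LeiZhang2017AxisymmetricCriteria.lean`), after D. Wei, *Regularity criterion to the axially
symmetric Navier–Stokes equations*, J. Math. Anal. Appl. 435 (2016) 402–413 = arXiv:1508.03318,
§3, from "(3.1) `½ d/dt ‖J‖² + ‖∇J‖² = …`" to "(3.6) `d/dt A + ‖∇J‖² + ε^{2/3}‖∇Ω‖² ≤ …`".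

`Wei2016.slice_inequality` assembles, for a classical solution `(v, q)` of the unforced system
(`ν = 1`) with axisymmetric `H^∞` slices, at a time `t`, the tree's fixed-time inequalities

* `IsClassicalNSSolutionOn.angVortQuot_energy_le` — (3.2): `∫ΩΩ' + ∫|∇Ω|² ≤ −2∫ Ω Φ J`,
* `IsClassicalNSSolutionOn.radVelQuot_curl_energy_le` + `integral_mul_fderiv_apply_curl_le` —
  (3.1): `∫JJ' + ∫|∇J|² ≤ ½∫|∇J|² + ½∫ u_θ²|∇W|²`,
* `Wei2016.integral_abs_swirlVelocity_div_mul_sq_le` (Lemma 2.3 (2.3)) with `f = Ω` and `f = J`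
  — (3.3)–(3.4),
* `Wei2016.integral_swirlVelocity_sq_mul_gradSq_le` ((2.4) for `∇W`) with the Hessian–Laplacian
  identity and Lemma 2.1 (`IsAxisymmetric.integral_laplacian_radVelQuot_sq_le`) — (3.5),

into the real-variable skeleton `Wei2016.slice_combination`, with the Hardy constant of
Lemma 2.3 run at `θ ε^{-1/3}` (`ε(1 + ln K + ½ln²K) = θ/p`, `p = ε^{1/3}`), which leaves the
fraction `1 − θ` of the dissipation:

`∫JJ' + (p²/2)∫ΩΩ' + ((1−θ)/2)∫|∇J|² + (1−θ)(p²/2)∫|∇Ω|²`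
`  ≤ (C₂/2) ∫_{r>r₁/2}|∇W|² + (p²/2)(p C₁ ∫_{r>r₁/2}Ω² + p⁻¹ C₁ ∫_{r>r₁/2}J²)`,

`C₁ = hardyConst (Γ_b + θ/p)/r₁²`, `C₂ = hardyConst (Γ_b² + θp²)/r₁²`, under Lemma 2.3's
hypotheses at time `t` (`|Γ| ≤ ε` on `{r ≤ r₁}`, `|Γ| ≤ Γ_b`, `∫₀ʳ|u_θ| ≤ r a` on rays `r ≤ r₁`,
`r₁ ≤ εK/a`). Here `Ω = ω_θ/r = angVortQuot`, `J = ω_r/r = radVelQuot ∘ curl`, `W = u_r/r =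
radVelQuot`, `Φ = u_θ/r = angVelQuot` are the smooth Hou–Li variables of the tree and `Ω'`, `J'`
those of `∂ₜv` (within the time set).

## References

* D. Wei, arXiv:1508.03318, §3, (3.1)–(3.6). [Wei2016]
* Z. Lei, Q. S. Zhang, arXiv:1505.02628, §3 (3.1)–(3.3) (the same computation). [LeiZhang2017]
-/

noncomputable section

open MeasureTheory Set Function Filter Topology InnerProductSpace intervalIntegral
open scoped RealInnerProductSpace Laplacian ContDiff ENNReal

namespace Literature.Analysis.FluidPDE

namespace Wei2016

/-! ### Pointwise facts -/

/-- `(DG[e_r])² ≤ (∂₀G)² + (∂₁G)²` (`e_r` is a horizontal unit vector off the axis, `0` on it).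
[folklore] -/
theorem sq_partialDeriv_eR_le_horizontal (G : EuclideanSpace ℝ (Fin 3) → ℝ) (x : EuclideanSpace ℝ (Fin 3)) :
    partialDeriv (eR x) G x ^ 2 ≤
      fderiv ℝ G x (EuclideanSpace.single 0 1) ^ 2 + fderiv ℝ G x (EuclideanSpace.single 1 1) ^ 2 := by
  have he : partialDeriv (eR x) G x = (cylRadius x)⁻¹ * (x 0 * fderiv ℝ G x (EuclideanSpace.single 0 1) +
      x 1 * fderiv ℝ G x (EuclideanSpace.single 1 1)) := by
    rw [partialDeriv, eR, map_smul, smul_eq_mul, toLp_horizontal_eq_add_single, map_add, map_smul,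
      map_smul, smul_eq_mul, smul_eq_mul]
  rw [he]
  by_cases hx : cylRadius x = 0
  · rw [hx, inv_zero, zero_mul, sq, mul_zero]
    positivity
  · have hr : 0 < cylRadius x := lt_of_le_of_ne (cylRadius_nonneg x) (Ne.symm hx)
    have hr2 := cylRadius_sq x
    rw [mul_pow, inv_pow, inv_mul_le_iff₀ (pow_pos hr 2), hr2]
    nlinarith [sq_nonneg (x 0 * fderiv ℝ G x (EuclideanSpace.single 1 1) -
      x 1 * fderiv ℝ G x (EuclideanSpace.single 0 1))]

/-- `u_θ² = Γ²/(x₀² + x₁²)` everywhere (both vanish on the axis: `e_θ = 0` there and `·/0 = 0`).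
[folklore] -/
theorem swirlVelocity_sq_eq (u : EuclideanSpace ℝ (Fin 3) → EuclideanSpace ℝ (Fin 3))
    (x : EuclideanSpace ℝ (Fin 3)) :
    swirlVelocity u x ^ 2 = swirl u x ^ 2 / (x 0 ^ 2 + x 1 ^ 2) := by
  have he : swirlVelocity u x = (cylRadius x)⁻¹ * swirl u x := by
    rw [swirlVelocity, show eTheta x = (cylRadius x)⁻¹ • rotGen x from rfl, real_inner_smul_right,
      real_inner_comm, congrFun (swirl_eq_inner_rotGen u) x]
  rw [he, mul_pow, ← cylRadius_sq, inv_pow, div_eq_inv_mul]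

/-- `|u_θ|/r = |Φ|` off the axis (`Φ = angVelQuot u`, `r²Φ = Γ`, `u_θ = Γ/r`). [folklore] -/
theorem abs_swirlVelocity_div_eq_abs_angVelQuot {u : EuclideanSpace ℝ (Fin 3) → EuclideanSpace ℝ (Fin 3)}
    (hax : IsAxisymmetric u) (hu : ContDiff ℝ 2 u) {x : EuclideanSpace ℝ (Fin 3)} (hx : cylRadius x ≠ 0) :
    |swirlVelocity u x| / cylRadius x = |angVelQuot u x| := by
  have hr : 0 < cylRadius x := lt_of_le_of_ne (cylRadius_nonneg x) (Ne.symm hx)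
  have he : swirlVelocity u x = (cylRadius x)⁻¹ * swirl u x := by
    rw [swirlVelocity, show eTheta x = (cylRadius x)⁻¹ • rotGen x from rfl, real_inner_smul_right,
      real_inner_comm, congrFun (swirl_eq_inner_rotGen u) x]
  have hΦ := hax.cylRadius_sq_mul_angVelQuot hu x
  -- `Φ = Γ/r²`
  have hΦ' : angVelQuot u x = swirl u x / cylRadius x ^ 2 := by
    rw [eq_div_iff (pow_ne_zero 2 hx), mul_comm, hΦ]
  rw [he, hΦ', abs_mul, abs_inv, abs_of_pos hr, abs_div, abs_of_pos (pow_pos hr 2)]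
  field_simp

/-! ### `H^∞` bookkeeping for the vorticity -/

/-- The vorticity of an `H^∞` field is `H^∞`: `∫ ‖Dⁿ(curl u)‖² ≤ ‖curlCLM‖² ∫ ‖Dⁿ⁺¹u‖² < ∞`.
[folklore] -/
theorem lintegral_sq_iteratedFDeriv_curl_lt_top {u : EuclideanSpace ℝ (Fin 3) → EuclideanSpace ℝ (Fin 3)}
    (hu : ContDiff ℝ ∞ u) (hH : ∀ n : ℕ, ∫⁻ x, ‖iteratedFDeriv ℝ n u x‖ₑ ^ 2 < ⊤) (n : ℕ) :
    ∫⁻ x, ‖iteratedFDeriv ℝ n (curl u) x‖ₑ ^ 2 < ⊤ := by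
  set c : ℝ := ‖(curlCLM : (EuclideanSpace ℝ (Fin 3) →L[ℝ] EuclideanSpace ℝ (Fin 3)) →L[ℝ]
      EuclideanSpace ℝ (Fin 3))‖ with hc
  have hle : ∀ x, ‖iteratedFDeriv ℝ n (curl u) x‖ₑ ^ 2 ≤
      ENNReal.ofReal (c ^ 2) * ‖iteratedFDeriv ℝ (n + 1) u x‖ₑ ^ 2 := fun x => by
    have h := norm_iteratedFDeriv_curl_le (n := n) (hu.of_le (by norm_cast; exact le_top)) x
    rw [← ofReal_norm, ← ofReal_norm, ← ENNReal.ofReal_pow (norm_nonneg _),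
      ← ENNReal.ofReal_pow (norm_nonneg _), ← ENNReal.ofReal_mul (sq_nonneg _)]
    refine ENNReal.ofReal_le_ofReal ?_
    rw [← mul_pow]
    exact pow_le_pow_left₀ (norm_nonneg _) h 2
  refine lt_of_le_of_lt (lintegral_mono hle) ?_
  rw [lintegral_const_mul' _ _ ENNReal.ofReal_ne_top]
  exact ENNReal.mul_lt_top ENNReal.ofReal_lt_top (hH (n + 1))

/-! ### The slice inequality -/

section Slice

variable {S : Set ℝ} {v : ℝ → EuclideanSpace ℝ (Fin 3) → EuclideanSpace ℝ (Fin 3)}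
  {q : ℝ → EuclideanSpace ℝ (Fin 3) → ℝ}

set_option maxHeartbeats 1600000 in
/-- **Wei 2016, (3.1)–(3.6) at a fixed time.** Let `(v, q)` be a classical solution of the
unforced Navier–Stokes system with `ν = 1` on a time set `S ⊆ closure (interior S)` of unique
differentiability, with axisymmetric slices, and let `t ∈ S` be a time at which `v t ∈ H^∞`
(all `L²` Sobolev norms finite) and `v t`, `Dv(t)` are bounded. Let `0 < ε`, `0 < p` with
`p³ = ε`, `0 ≤ θ`, `K ≥ 1`, `0 < r₁ ≤ εK/a`, `a > 0`, and `ε(1 + ln K + ½ ln²K) = θ/p`; assume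
`|Γ(t, x)| ≤ ε` for `0 < r ≤ r₁`, `|Γ(t, x)| ≤ Γ_b` everywhere and `∫₀ʳ |u_θ(t, s, 0, z)| ds ≤ r a`
for `0 < r ≤ r₁` (hypotheses of Lemma 2.3). Then, with `Ω = angVortQuot (v t)`,
`Ω' = angVortQuot (∂ₜv t)`, `J = radVelQuot (curl (v t))`, `J' = radVelQuot (curl (∂ₜv t))`,
`W = radVelQuot (v t)`, `|∇G|² = Σᵢ(∂ᵢG)²`, `C₁ = hardyConst (Γ_b + θ/p)/r₁²`,
`C₂ = hardyConst (Γ_b² + θp²)/r₁²`: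
`∫JJ' + (p²/2)∫ΩΩ' + ((1−θ)/2)∫|∇J|² + (1−θ)(p²/2)∫|∇Ω|²`
`  ≤ (C₂/2)∫_{r>r₁/2}|∇W|² + (p²/2)(pC₁∫_{r>r₁/2}Ω² + p⁻¹C₁∫_{r>r₁/2}J²)`.
[cite: Wei2016, §3 (3.1)–(3.6)] -/
theorem slice_inequality (hns : IsClassicalNSSolutionOn S 1 0 v q)
    (hS : UniqueDiffOn ℝ S) (hcl : S ⊆ closure (interior S))
    (hax : ∀ s ∈ S, IsAxisymmetric (v s)) {t : ℝ} (ht : t ∈ S)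
    (hH : ∀ n : ℕ, ∫⁻ x, ‖iteratedFDeriv ℝ n (v t) x‖ₑ ^ 2 < ⊤)
    {B : ℝ} (hbB : ∀ x, ‖v t x‖ ≤ B) {B' : ℝ} (hDb : ∀ x, ‖fderiv ℝ (v t) x‖ ≤ B')
    {ε p θ K r₁ a Γb : ℝ} (hε : 0 < ε) (hp : 0 < p) (hp3 : p ^ 3 = ε) (hθ0 : 0 ≤ θ)
    (hK : 1 ≤ K) (hr₁ : 0 < r₁) (ha : 0 < a) (hr₁K : r₁ ≤ ε * K / a)
    (hM : ε * (1 + Real.log K + Real.log K ^ 2 / 2) = θ / p)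
    (hΓε : ∀ x, 0 < cylRadius x → cylRadius x ≤ r₁ → |swirl (v t) x| ≤ ε)
    (hΓb : ∀ x, |swirl (v t) x| ≤ Γb)
    (hray : ∀ z r : ℝ, 0 < r → r ≤ r₁ →
      ∫ s in (0 : ℝ)..r, |swirlVelocity (v t) (meridianPoint (s, z))| ≤ r * a) :
    (∫ x, radVelQuot (curl (v t)) x * radVelQuot (curl (timeDerivWithin S v t)) x) +
      p ^ 2 / 2 * (∫ x, angVortQuot (v t) x * angVortQuot (timeDerivWithin S v t) x) +
      (1 - θ) / 2 * (∫ x, (fderiv ℝ (radVelQuot (curl (v t))) x (EuclideanSpace.single 0 1) ^ 2 +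
        fderiv ℝ (radVelQuot (curl (v t))) x (EuclideanSpace.single 1 1) ^ 2 +
        fderiv ℝ (radVelQuot (curl (v t))) x (EuclideanSpace.single 2 1) ^ 2)) +
      (1 - θ) * (p ^ 2 / 2) * (∫ x, (fderiv ℝ (angVortQuot (v t)) x (EuclideanSpace.single 0 1) ^ 2 +
        fderiv ℝ (angVortQuot (v t)) x (EuclideanSpace.single 1 1) ^ 2 +
        fderiv ℝ (angVortQuot (v t)) x (EuclideanSpace.single 2 1) ^ 2)) ≤
      hardyConst * (Γb ^ 2 + θ * p ^ 2) / r₁ ^ 2 / 2 *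
          (∫ x in {x | r₁ / 2 < cylRadius x},
            (fderiv ℝ (radVelQuot (v t)) x (EuclideanSpace.single 0 1) ^ 2 +
              fderiv ℝ (radVelQuot (v t)) x (EuclideanSpace.single 1 1) ^ 2 +
              fderiv ℝ (radVelQuot (v t)) x (EuclideanSpace.single 2 1) ^ 2)) +
        p ^ 2 / 2 * (p * (hardyConst * (Γb + θ / p) / r₁ ^ 2) *
            (∫ x in {x | r₁ / 2 < cylRadius x}, angVortQuot (v t) x ^ 2) +
          p⁻¹ * (hardyConst * (Γb + θ / p) / r₁ ^ 2) *
            ∫ x in {x | r₁ / 2 < cylRadius x}, radVelQuot (curl (v t)) x ^ 2) := by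
  -- names
  set u : EuclideanSpace ℝ (Fin 3) → EuclideanSpace ℝ (Fin 3) := v t with hu_def
  set e : Fin 3 → EuclideanSpace ℝ (Fin 3) := fun i => EuclideanSpace.single i 1 with he
  have he' : ∀ i, EuclideanSpace.single i (1 : ℝ) = e i := fun i => rfl
  set Ω : EuclideanSpace ℝ (Fin 3) → ℝ := angVortQuot u with hΩ
  set Ω' : EuclideanSpace ℝ (Fin 3) → ℝ := angVortQuot (timeDerivWithin S v t) with hΩ'
  set J : EuclideanSpace ℝ (Fin 3) → ℝ := radVelQuot (curl u) with hJ
  set J' : EuclideanSpace ℝ (Fin 3) → ℝ := radVelQuot (curl (timeDerivWithin S v t)) with hJ'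
  set W : EuclideanSpace ℝ (Fin 3) → ℝ := radVelQuot u with hW
  set Φ : EuclideanSpace ℝ (Fin 3) → ℝ := angVelQuot u with hΦ
  -- smoothness
  have haxu : IsAxisymmetric u := hax t ht
  have hu : ContDiff ℝ ∞ u := hns.contDiff_velocity ht
  have hu1 : ContDiff ℝ 1 u := hu.of_le (by norm_cast)
  have hu2 : ContDiff ℝ 2 u := hu.of_le (by norm_cast)
  have hu3 : ContDiff ℝ 3 u := hu.of_le (by norm_cast)
  have hu5 : ContDiff ℝ 5 u := hu.of_le (by norm_cast)
  have hud : Differentiable ℝ u := hu1.differentiable one_ne_zero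
  have huc : Continuous u := hud.continuous
  have hω : ContDiff ℝ ∞ (curl u) := by
    rw [curl_eq_curlCLM_comp]
    exact curlCLM.contDiff.comp (hu.fderiv_right (m := ∞) (by simp))
  have hω2 : ContDiff ℝ 2 (curl u) := hω.of_le (by norm_cast)
  have haxω : IsAxisymmetric (curl u) := haxu.curl hud
  have hΩs : ContDiff ℝ ∞ Ω := contDiff_angVortQuot_of_contDiff hu
  have hJs : ContDiff ℝ ∞ J := contDiff_radVelQuot_of_contDiff hω
  have hWs : ContDiff ℝ ∞ W := contDiff_radVelQuot_of_contDiff hu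
  have hΦs : ContDiff ℝ ∞ Φ := contDiff_angVelQuot_of_contDiff hu
  have hΩ1 : ContDiff ℝ 1 Ω := hΩs.of_le (by norm_cast)
  have hJ1 : ContDiff ℝ 1 J := hJs.of_le (by norm_cast)
  have hΩ2 : ContDiff ℝ 2 Ω := hΩs.of_le (by norm_cast)
  have hJ2 : ContDiff ℝ 2 J := hJs.of_le (by norm_cast)
  have hW2 : ContDiff ℝ 2 W := hWs.of_le (by norm_cast)
  have hW3 : ContDiff ℝ 3 W := hWs.of_le (by norm_cast)
  have hΩax : IsAxisymmetricScalar Ω := haxu.isAxisymmetricScalar_angVortQuot hu3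
  have hJax : IsAxisymmetricScalar J := haxω.isAxisymmetricScalar_radVelQuot hω2
  have hWax : IsAxisymmetricScalar W := haxu.isAxisymmetricScalar_radVelQuot hu2
  -- `H^∞` finiteness of the quotients
  have hωfin := lintegral_sq_iteratedFDeriv_curl_lt_top hu hH
  have hΩfin := haxu.lintegral_sq_iteratedFDeriv_angVortQuot_lt_top hu hH
  have hWfin := haxu.lintegral_sq_iteratedFDeriv_radVelQuot_lt_top hu hH
  have hJfin := haxω.lintegral_sq_iteratedFDeriv_radVelQuot_lt_top hω hωfin
  have hn := norm_euclideanSpace_single_one_le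
  -- `L²` atoms
  have aΩ0 : MemLp Ω 2 volume := memLp_of_sobolev hΩs hΩfin
  have aJ0 : MemLp J 2 volume := memLp_of_sobolev hJs hJfin
  have aΩ1 : ∀ i : Fin 3, MemLp (fun x => fderiv ℝ Ω x (e i)) 2 volume := fun i =>
    memLp_fderiv_apply_of_sobolev hΩs hΩfin (hn i)
  have aJ1 : ∀ i : Fin 3, MemLp (fun x => fderiv ℝ J x (e i)) 2 volume := fun i =>
    memLp_fderiv_apply_of_sobolev hJs hJfin (hn i)
  have aW1 : ∀ i : Fin 3, MemLp (fun x => fderiv ℝ W x (e i)) 2 volume := fun i =>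
    memLp_fderiv_apply_of_sobolev hWs hWfin (hn i)
  have aΩ2 : ∀ i j : Fin 3, MemLp (fun x => fderiv ℝ (fun y => fderiv ℝ Ω y (e i)) x (e j)) 2 volume :=
    fun i j => memLp_fderiv_fderiv_apply_of_sobolev hΩs hΩfin (hn i) (hn j)
  have aJ2 : ∀ i j : Fin 3, MemLp (fun x => fderiv ℝ (fun y => fderiv ℝ J y (e i)) x (e j)) 2 volume :=
    fun i j => memLp_fderiv_fderiv_apply_of_sobolev hJs hJfin (hn i) (hn j)
  have aW2 : ∀ i j : Fin 3, MemLp (fun x => fderiv ℝ (fun y => fderiv ℝ W y (e i)) x (e j)) 2 volume :=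
    fun i j => memLp_fderiv_fderiv_apply_of_sobolev hWs hWfin (hn i) (hn j)
  have aW3 : ∀ i j k : Fin 3, MemLp (fun x => fderiv ℝ (fun z => fderiv ℝ (fun y => fderiv ℝ W y (e i)) z
      (e j)) x (e k)) 2 volume :=
    fun i j k => memLp_fderiv_fderiv_fderiv_apply_of_sobolev hWs hWfin (hn i) (hn j) (hn k)
  have aΩq : MemLp (radDerivQuot Ω) 2 volume := (memLp_radDerivQuot_of_sobolev hΩs hΩfin).1
  have aJq : MemLp (radDerivQuot J) 2 volume := (memLp_radDerivQuot_of_sobolev hJs hJfin).1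
  have aWq : MemLp (radDerivQuot W) 2 volume := (memLp_radDerivQuot_of_sobolev hWs hWfin).1
  have aWqH : MemLp (radDerivQuot fun y => fderiv ℝ W y (e 2)) 2 volume :=
    memLp_radDerivQuot_fderiv_apply_of_sobolev hWs hWfin (hn 2)
  have aWx0 := hWax.memLp_coord_mul_fderiv_radDerivQuot_of_sobolev hWs hWfin (Or.inl rfl)
  have aWx1 := hWax.memLp_coord_mul_fderiv_radDerivQuot_of_sobolev hWs hWfin (Or.inr rfl)
  -- bounds: `B, B' ≥ 0`, `|Φ| ≤ B'`, `‖ω‖ ≤ ‖curlCLM‖ B'`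
  have hB0 : 0 ≤ B := (norm_nonneg _).trans (hbB 0)
  have hB'0 : 0 ≤ B' := (norm_nonneg _).trans (hDb 0)
  have hΦB : ∀ x, |Φ x| ≤ B' := fun x => (haxu.abs_angVelQuot_le_norm_fderiv hu2 x).trans (hDb x)
  set cω : ℝ := ‖(curlCLM : (EuclideanSpace ℝ (Fin 3) →L[ℝ] EuclideanSpace ℝ (Fin 3)) →L[ℝ]
      EuclideanSpace ℝ (Fin 3))‖ with hcω
  have hcω0 : 0 ≤ cω := by
    rw [hcω]
    exact norm_nonneg (curlCLM : (EuclideanSpace ℝ (Fin 3) →L[ℝ] EuclideanSpace ℝ (Fin 3)) →L[ℝ]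
      EuclideanSpace ℝ (Fin 3))
  have hωB : ∀ x, ‖curl u x‖ ≤ cω * B' := fun x =>
    (norm_curl_le u x).trans (mul_le_mul_of_nonneg_left (hDb x) hcω0)
  -- continuity of the quotients (measurability)
  have hΩc : Continuous Ω := hΩ1.continuous
  have hJc : Continuous J := hJ1.continuous
  have hΦc : Continuous Φ := hΦs.continuous
  ----------------------------------------------------------------
  -- (3.2): the `Ω`-inequality
  ----------------------------------------------------------------
  have iΩΦJ : Integrable (fun x => Ω x * (Φ x * J x)) volume := by
    have h : Integrable (fun x => Ω x * J x) volume := aΩ0.integrable_mul aJ0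
    refine (h.bdd_mul (c := B') hΦc.aestronglyMeasurable (Eventually.of_forall fun x => ?_)).congr
      (Eventually.of_forall fun x => by ring)
    rw [Real.norm_eq_abs]; exact hΦB x
  have hΩineq := hns.angVortQuot_energy_le hS hcl hax zero_le_one ht aΩ0
    (fun i => aΩ1 i) (fun i => aΩ2 i i) aΩq iΩΦJ hbB hDb
  rw [one_mul] at hΩineq
  ----------------------------------------------------------------
  -- (3.1): the `J`-inequality and the source estimate
  ----------------------------------------------------------------
  have iJDW : Integrable (fun x => J x * fderiv ℝ W x (curl u x)) volume := by
    -- `DW[ω] = Σᵢ ωᵢ ∂ᵢW` with `ω` bounded and `J ∂ᵢW ∈ L¹`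
    have hsum : ∀ x, fderiv ℝ W x (curl u x) = ∑ i : Fin 3, curl u x i * fderiv ℝ W x (e i) := by
      intro x
      rw [fderiv_apply_eq_sum_three W x (curl u x), Fin.sum_univ_three]
    have hI : ∀ i : Fin 3, Integrable (fun x => curl u x i * (J x * fderiv ℝ W x (e i))) volume := by
      intro i
      have h := aJ0.integrable_mul (aW1 i)
      refine h.bdd_mul (c := cω * B') ?_ (Eventually.of_forall fun x => ?_)
      · exact ((EuclideanSpace.proj i).continuous.comp (hω.continuous)).aestronglyMeasurable
      · have h1 : ‖curl u x i‖ ≤ ‖curl u x‖ := PiLp.norm_apply_le (curl u x) i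
        exact h1.trans (hωB x)
    have h := integrable_finsetSum Finset.univ fun i _ => hI i
    refine h.congr (Eventually.of_forall fun x => ?_)
    simp only [hsum x, Finset.mul_sum]
    exact Finset.sum_congr rfl fun i _ => by ring
  have hJineq := hns.radVelQuot_curl_energy_le hS hcl hax zero_le_one ht aJ0
    (fun i => aJ1 i) (fun i => aJ2 i i) aJq iJDW hbB hDb
  rw [one_mul] at hJineq
  have hsrc := integral_mul_fderiv_apply_curl_le hJ2 hW2 hu1 hJax hWax aJ0 aW1 aJ1 aW2 hbB hDb
  ----------------------------------------------------------------
  -- the axis is null; `|Φ| = |u_θ|/r` a.e.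
  ----------------------------------------------------------------
  have hae : ∀ᵐ x ∂(volume : Measure (EuclideanSpace ℝ (Fin 3))), cylRadius x ≠ 0 := by
    rw [ae_iff]
    refine measure_mono_null (fun x hx => ?_) volume_axis_eq_zero
    have hx' : cylRadius x = 0 := by simpa using hx
    have h2 : cylRadius x ^ 2 = 0 := by rw [hx']; ring
    show x 0 ^ 2 + x 1 ^ 2 = 0
    linarith [cylRadius_sq x]
  have hΦae : ∀ᵐ x ∂(volume : Measure (EuclideanSpace ℝ (Fin 3))),
      |swirlVelocity u x| / cylRadius x = |Φ x| :=
    hae.mono fun x hx => abs_swirlVelocity_div_eq_abs_angVelQuot haxu hu2 hx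
  -- integrability of the weighted squares
  have hsvm : Measurable (swirlVelocity u) := measurable_swirlVelocity huc
  have hwm : AEStronglyMeasurable (fun x => |swirlVelocity u x| / cylRadius x) volume :=
    ((continuous_abs.measurable.comp hsvm).div continuous_cylRadius.measurable).aestronglyMeasurable
  have iΦΩ2 : Integrable (fun x => |Φ x| * Ω x ^ 2) volume := by
    refine (aΩ0.integrable_sq.bdd_mul (c := B') (continuous_abs.comp hΦc).aestronglyMeasurable
      (Eventually.of_forall fun x => ?_))
    rw [Real.norm_eq_abs, abs_abs]; exact hΦB x
  have iΦJ2 : Integrable (fun x => |Φ x| * J x ^ 2) volume := by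
    refine (aJ0.integrable_sq.bdd_mul (c := B') (continuous_abs.comp hΦc).aestronglyMeasurable
      (Eventually.of_forall fun x => ?_))
    rw [Real.norm_eq_abs, abs_abs]; exact hΦB x
  have iXΩ : Integrable (fun x => |swirlVelocity u x| / cylRadius x * Ω x ^ 2) volume := by
    refine (iΦΩ2.congr (hΦae.mono fun x hx => ?_))
    simp only [hx]
  have iXJ : Integrable (fun x => |swirlVelocity u x| / cylRadius x * J x ^ 2) volume := by
    refine (iΦJ2.congr (hΦae.mono fun x hx => ?_))
    simp only [hx]
  have hXeq : ∫ x, |swirlVelocity u x| / cylRadius x * Ω x ^ 2 = ∫ x, |Φ x| * Ω x ^ 2 :=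
    integral_congr_ae (hΦae.mono fun x hx => by simp only [hx])
  have hYeq : ∫ x, |swirlVelocity u x| / cylRadius x * J x ^ 2 = ∫ x, |Φ x| * J x ^ 2 :=
    integral_congr_ae (hΦae.mono fun x hx => by simp only [hx])
  ----------------------------------------------------------------
  -- hΩ : `IΩ + DΩ ≤ p X + p⁻¹ Y` (Young `2|Φ||Ω||J| ≤ p|Φ|Ω² + p⁻¹|Φ|J²`)
  ----------------------------------------------------------------
  have hYoung : -2 * (∫ x, Ω x * (Φ x * J x)) ≤
      p * (∫ x, |swirlVelocity u x| / cylRadius x * Ω x ^ 2) +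
        p⁻¹ * ∫ x, |swirlVelocity u x| / cylRadius x * J x ^ 2 := by
    rw [hXeq, hYeq, ← MeasureTheory.integral_const_mul, ← MeasureTheory.integral_const_mul,
      ← MeasureTheory.integral_const_mul, ← integral_add (iΦΩ2.const_mul p) (iΦJ2.const_mul p⁻¹)]
    refine integral_mono (iΩΦJ.const_mul _) ((iΦΩ2.const_mul p).add (iΦJ2.const_mul p⁻¹))
      fun x => ?_
    -- pointwise
    have h1 : -2 * (Ω x * (Φ x * J x)) ≤ 2 * |Φ x| * (|Ω x| * |J x|) := by
      have := abs_mul (Ω x) (Φ x * J x)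
      have := abs_mul (Φ x) (J x)
      nlinarith [neg_abs_le (Ω x * (Φ x * J x)), abs_nonneg (Ω x), abs_nonneg (Φ x), abs_nonneg (J x)]
    have h2 : 2 * (|Ω x| * |J x|) ≤ p * Ω x ^ 2 + p⁻¹ * J x ^ 2 := by
      have hexp : p * (p * Ω x ^ 2 + p⁻¹ * J x ^ 2) = (p * |Ω x|) ^ 2 + |J x| ^ 2 := by
        rw [mul_pow, sq_abs, sq_abs]
        field_simp
      refine le_of_mul_le_mul_left ?_ hp
      rw [hexp]
      nlinarith [sq_nonneg (p * |Ω x| - |J x|), abs_nonneg (Ω x), abs_nonneg (J x)]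
    calc -2 * (Ω x * (Φ x * J x)) ≤ |Φ x| * (2 * (|Ω x| * |J x|)) := by linarith
      _ ≤ |Φ x| * (p * Ω x ^ 2 + p⁻¹ * J x ^ 2) := mul_le_mul_of_nonneg_left h2 (abs_nonneg _)
      _ = p * (|Φ x| * Ω x ^ 2) + p⁻¹ * (|Φ x| * J x ^ 2) := by ring
  have hΩ' : (∫ x, Ω x * Ω' x) + (∫ x, (fderiv ℝ Ω x (e 0) ^ 2 + fderiv ℝ Ω x (e 1) ^ 2 +
      fderiv ℝ Ω x (e 2) ^ 2)) ≤
      p * (∫ x, |swirlVelocity u x| / cylRadius x * Ω x ^ 2) +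
        p⁻¹ * ∫ x, |swirlVelocity u x| / cylRadius x * J x ^ 2 := hΩineq.trans hYoung
  ----------------------------------------------------------------
  -- hJ : `IJ + DJ ≤ DJ/2 + S/2`, `S = ∫ u_θ² |∇W|²`
  ----------------------------------------------------------------
  set NW : EuclideanSpace ℝ (Fin 3) → ℝ := fun x =>
    fderiv ℝ W x (e 0) ^ 2 + fderiv ℝ W x (e 1) ^ 2 + fderiv ℝ W x (e 2) ^ 2 with hNW
  have hSeq : ∫ x, swirl u x ^ 2 / (x 0 ^ 2 + x 1 ^ 2) * NW x = ∫ x, swirlVelocity u x ^ 2 * NW x :=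
    integral_congr_ae (Eventually.of_forall fun x => by beta_reduce; rw [swirlVelocity_sq_eq])
  have hJ' : (∫ x, J x * J' x) + (∫ x, (fderiv ℝ J x (e 0) ^ 2 + fderiv ℝ J x (e 1) ^ 2 +
      fderiv ℝ J x (e 2) ^ 2)) ≤
      (∫ x, (fderiv ℝ J x (e 0) ^ 2 + fderiv ℝ J x (e 1) ^ 2 + fderiv ℝ J x (e 2) ^ 2)) / 2 +
        (∫ x, swirlVelocity u x ^ 2 * NW x) / 2 := by
    have h := hJineq.trans hsrc
    rw [hSeq] at h
    linarith
  ----------------------------------------------------------------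
  -- hX, hY : Lemma 2.3 (2.3) with `f = Ω`, `f = J`
  ----------------------------------------------------------------
  have hBΩ : Integrable (fun x => partialDeriv (eR x) Ω x ^ 2) volume := by
    have hm := measurable_partialDeriv_eR hΩ1
    refine (((aΩ1 0).integrable_sq.add (aΩ1 1).integrable_sq)).mono (hm.pow_const 2).aestronglyMeasurable
      (Eventually.of_forall fun x => ?_)
    simp only [Pi.add_apply, Real.norm_eq_abs]
    rw [abs_of_nonneg (sq_nonneg _), abs_of_nonneg (by positivity)]
    exact sq_partialDeriv_eR_le_horizontal Ω x
  have hBJ : Integrable (fun x => partialDeriv (eR x) J x ^ 2) volume := by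
    have hm := measurable_partialDeriv_eR hJ1
    refine (((aJ1 0).integrable_sq.add (aJ1 1).integrable_sq)).mono (hm.pow_const 2).aestronglyMeasurable
      (Eventually.of_forall fun x => ?_)
    simp only [Pi.add_apply, Real.norm_eq_abs]
    rw [abs_of_nonneg (sq_nonneg _), abs_of_nonneg (by positivity)]
    exact sq_partialDeriv_eR_le_horizontal J x
  have h23Ω := integral_abs_swirlVelocity_div_mul_sq_le haxu huc hΩax hΩ1 hε ha hK hr₁ hr₁K hΓε hΓb
    hray iXΩ hBΩ aΩ0.integrable_sq
  have h23J := integral_abs_swirlVelocity_div_mul_sq_le haxu huc hJax hJ1 hε ha hK hr₁ hr₁K hΓε hΓb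
    hray iXJ hBJ aJ0.integrable_sq
  rw [hM] at h23Ω h23J
  have hrΩ : ∫ x, partialDeriv (eR x) Ω x ^ 2 ≤ ∫ x, (fderiv ℝ Ω x (e 0) ^ 2 + fderiv ℝ Ω x (e 1) ^ 2) :=
    integral_mono hBΩ ((aΩ1 0).integrable_sq.add (aΩ1 1).integrable_sq)
      fun x => sq_partialDeriv_eR_le_horizontal Ω x
  have hrJ : ∫ x, partialDeriv (eR x) J x ^ 2 ≤ ∫ x, (fderiv ℝ J x (e 0) ^ 2 + fderiv ℝ J x (e 1) ^ 2) :=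
    integral_mono hBJ ((aJ1 0).integrable_sq.add (aJ1 1).integrable_sq)
      fun x => sq_partialDeriv_eR_le_horizontal J x
  have hθp : 0 ≤ θ / p := div_nonneg hθ0 hp.le
  have hX : ∫ x, |swirlVelocity u x| / cylRadius x * Ω x ^ 2 ≤
      θ / p * (∫ x, (fderiv ℝ Ω x (e 0) ^ 2 + fderiv ℝ Ω x (e 1) ^ 2)) +
        hardyConst * (Γb + θ / p) / r₁ ^ 2 * ∫ x in {x | r₁ / 2 < cylRadius x}, Ω x ^ 2 :=
    h23Ω.trans (by nlinarith [mul_le_mul_of_nonneg_left hrΩ hθp])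
  have hY : ∫ x, |swirlVelocity u x| / cylRadius x * J x ^ 2 ≤
      θ / p * (∫ x, (fderiv ℝ J x (e 0) ^ 2 + fderiv ℝ J x (e 1) ^ 2)) +
        hardyConst * (Γb + θ / p) / r₁ ^ 2 * ∫ x in {x | r₁ / 2 < cylRadius x}, J x ^ 2 :=
    h23J.trans (by nlinarith [mul_le_mul_of_nonneg_left hrJ hθp])
  ----------------------------------------------------------------
  -- hS : (2.4) for `∇W`, `S ≤ p³ (θ/p) H + C₂ F_W`
  ----------------------------------------------------------------
  set HW : EuclideanSpace ℝ (Fin 3) → ℝ := fun x => ∑ i : Fin 3, ∑ j : Fin 3,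
    fderiv ℝ (fun y => fderiv ℝ W y (e i)) x (e j) ^ 2 with hHW
  have iNW : Integrable NW volume :=
    ((aW1 0).integrable_sq.add (aW1 1).integrable_sq).add (aW1 2).integrable_sq
  have iHW : Integrable HW volume :=
    integrable_finsetSum _ fun i _ => integrable_finsetSum _ fun j _ => (aW2 i j).integrable_sq
  have hNWc : Continuous NW := by
    have hg : ∀ i, Continuous fun x => fderiv ℝ W x (e i) := fun i =>
      (hW2.continuous_fderiv two_ne_zero).clm_apply continuous_const
    exact (((hg 0).pow 2).add ((hg 1).pow 2)).add ((hg 2).pow 2)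
  -- `|u_θ| ≤ ‖u‖` (`‖e_θ‖ ≤ 1`; the tree's `abs_swirlVelocity_le` of `AxisymPoloidalCutoff`, inlined)
  have hsvle : ∀ x, |swirlVelocity u x| ≤ ‖u x‖ := by
    intro x
    rw [swirlVelocity]
    refine (abs_real_inner_le_norm _ _).trans ?_
    have h : ‖eTheta x‖ ≤ 1 := by
      have hJn : ‖rotGen x‖ = cylRadius x := by rw [norm_rotGen, cylRadius]
      rw [show eTheta x = (cylRadius x)⁻¹ • rotGen x from rfl, norm_smul, hJn, Real.norm_eq_abs,
        abs_inv, abs_of_nonneg (cylRadius_nonneg x)]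
      by_cases hx : cylRadius x = 0
      · rw [hx]; simp
      · rw [inv_mul_cancel₀ hx]
    calc ‖u x‖ * ‖eTheta x‖ ≤ ‖u x‖ * 1 := mul_le_mul_of_nonneg_left h (norm_nonneg _)
      _ = ‖u x‖ := mul_one _
  have iSW : Integrable (fun x => swirlVelocity u x ^ 2 * NW x) volume := by
    refine iNW.bdd_mul (c := B ^ 2) (hsvm.pow_const 2).aestronglyMeasurable
      (Eventually.of_forall fun x => ?_)
    rw [Real.norm_eq_abs, abs_of_nonneg (sq_nonneg _), ← sq_abs]
    exact pow_le_pow_left₀ (abs_nonneg _) ((hsvle x).trans (hbB x)) 2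
  have h24 := integral_swirlVelocity_sq_mul_gradSq_le haxu huc hWax hW2 hε ha hK hr₁ hr₁K hΓε hΓb hray
    iSW iNW iHW
  rw [hM] at h24
  have hεθ : ε * (θ / p) = p ^ 3 * (θ / p) := by rw [hp3]
  have hεθ' : ε * (θ / p) = θ * p ^ 2 := by
    rw [← hp3]; field_simp
  have hS : ∫ x, swirlVelocity u x ^ 2 * NW x ≤ p ^ 3 * (θ / p) * (∫ x, HW x) +
      hardyConst * (Γb ^ 2 + θ * p ^ 2) / r₁ ^ 2 * ∫ x in {x | r₁ / 2 < cylRadius x}, NW x := by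
    rw [← hεθ, ← hεθ']
    exact h24
  ----------------------------------------------------------------
  -- hH : `H = ∫ Σ(∂ⱼ∂ᵢW)² = ∫ (ΔW)² ≤ ∫ (∂_zΩ)²` (Hessian–Laplacian, Lemma 2.1)
  ----------------------------------------------------------------
  have hdiv : VectorCalculus.IsDivFree u := hns.divFree t ht
  have hHL : ∫ x, HW x = ∫ x, (Δ W) x ^ 2 :=
    integral_sum_sq_fderiv_fderiv_eq_integral_laplacian_sq_of_memLp hW3 aW1 aW2 aW3
  have h21 := haxu.integral_laplacian_radVelQuot_sq_le hu5 hdiv aWq (aW1 0) (aW1 1) (aW1 2)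
    (aW2 0 0) (aW2 1 1) (aW2 2 2) aWx0 aWx1 aWqH
  have hHz : ∫ x, HW x ≤ ∫ x, fderiv ℝ Ω x (e 2) ^ 2 := by rw [hHL]; exact h21
  ----------------------------------------------------------------
  -- splitting of the dissipations
  ----------------------------------------------------------------
  have iΩ01 : Integrable (fun x => fderiv ℝ Ω x (e 0) ^ 2 + fderiv ℝ Ω x (e 1) ^ 2) volume :=
    (aΩ1 0).integrable_sq.add (aΩ1 1).integrable_sq
  have hDΩsplit : (∫ x, (fderiv ℝ Ω x (e 0) ^ 2 + fderiv ℝ Ω x (e 1) ^ 2)) + (∫ x, fderiv ℝ Ω x (e 2) ^ 2) ≤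
      ∫ x, (fderiv ℝ Ω x (e 0) ^ 2 + fderiv ℝ Ω x (e 1) ^ 2 + fderiv ℝ Ω x (e 2) ^ 2) :=
    le_of_eq (integral_add iΩ01 (aΩ1 2).integrable_sq).symm
  have hDJr : ∫ x, (fderiv ℝ J x (e 0) ^ 2 + fderiv ℝ J x (e 1) ^ 2) ≤
      ∫ x, (fderiv ℝ J x (e 0) ^ 2 + fderiv ℝ J x (e 1) ^ 2 + fderiv ℝ J x (e 2) ^ 2) :=
    integral_mono ((aJ1 0).integrable_sq.add (aJ1 1).integrable_sq)
      (((aJ1 0).integrable_sq.add (aJ1 1).integrable_sq).add (aJ1 2).integrable_sq)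
      fun x => by nlinarith [sq_nonneg (fderiv ℝ J x (e 2))]
  ----------------------------------------------------------------
  -- assemble
  ----------------------------------------------------------------
  have hmain := slice_combination (IJ := ∫ x, J x * J' x) (IΩ := ∫ x, Ω x * Ω' x) hp hθ0 hΩ' hJ' hX hY hS
    hHz hDJr hDΩsplit
  simpa only [hNW] using hmain

end Slice

end Wei2016

end Literature.Analysis.FluidPDE

end
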